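import Literature.Computability.Complexity.GapE3SATBoundedOccurrence
import Literature.Computability.Complexity.MaxTwoSat
import Literature.Computability.Complexity.CodeFPBudgets
import HarnessLib

/-!
# E3SAT with bounded variable occurrence as a decision LANGUAGE; occurrence bookkeeping of the
# Garey–Johnson–Stockmeyer gadgets and of a satisfiability-neutral padding

Topic `Computability/Complexity`. The tree has the PROMISE problem `gapE3SATOcc B ε` (gap-E3SAT with every
variable in at most `B` clauses) and its NP-hardness for `B = occB ggP` (`GapE3SATBoundedOccurrence.lean`, a
structural property of Dinur's reduction). This file records the plain DECISION consequences used by the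
bounded-slice-rank form of Bläser–Ikenmeyer–Jindal–Lysikov 2018, Thm. 4 (the "strengthened" statement after
their Obs. 17: "rk(Aᵢ) ≤ c for all i for some constant c" — the slice `Aᵢ` of the Max-2-SAT tensor has rank
equal to the number of literal positions on the variable `xᵢ`, so a constant `c` presupposes a bounded-occurrence
source):

* `E3SATOcc B` — the yes-side of `gapE3SATOcc B ε` as a language (codes of satisfiable E3-CNFs with every
  variable in at most `B` clauses); **`E3SATOcc_isNPHard_of_gap`**, **`E3SATOcc_occB_isNPHard`**,
  **`exists_E3SATOcc_isNPHard`** (with `1 ≤ B`) — a promise reduction into a problem with disjoint sides is a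
  Karp reduction to its yes-side (pattern of `EkSAT_three_isNPHard`);
* `CNF.litOcc` (number of literal positions on a variable) and `litOcc_le_mul_varOcc` (width `≤ w` ⇒
  `litOcc ≤ w · varOcc`); `occLE B φ` — the Boolean occurrence test, `occLE_eq_true_iff`, and its string
  function `occLEFP` in the typed `CodeFP` algebra;
* `MaxTwoSat.varOcc_gjs_le` — the Garey–Johnson–Stockmeyer 2-CNF `gjs φ` has every variable in at most
  `10 (varOcc φ x + 1)` clauses (each ten-clause gadget mentions only the variables of its clause and its own
  fresh variable); `MaxTwoSat.exists_numSatClauses_gjs_iff_of_isExactWidth` (`7m` clauses of `gjs φ` are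
  simultaneously satisfiable iff the E3-CNF `φ` is satisfiable — the tree's `reduce_spec` read for E3-CNFs);
* `padE3 j φ` — `φ` followed by `j` clauses `x_N ∨ x_{N+1} ∨ x_{N+2}`, `x_{N+3} ∨ …` on FRESH variables
  (`N = numVars φ`): exact width `3` and satisfiability are preserved (`isExactWidth_padE3`,
  `satisfiable_padE3_iff`), occurrence numbers grow by at most one and only on fresh variables
  (`varOcc_padE3_le`), `length_padE3`; string function `padE3FP`. (Used to push instance sizes above a
  threshold without changing the answer or the occurrence bound.)

No named facts; classical material. HONEST FRAMING (val-lit): Boolean bookkeeping for a conditional barrier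
statement of BIJL 2018 about the varieties `C^{n,t,c}_r`; nothing here bears on `VP ≠ VNP`, which is NOT proved.

## References

* [BlaserIkenmeyerJindalLysikov2018] M. Bläser, C. Ikenmeyer, G. Jindal, V. Lysikov, *Generalized matrix
  completion and algebraic natural proofs*, STOC 2018 / ECCC TR18-064, Obs. 17 and the remark after it
  (ECCC p. 12), §5 p. 13 (bounded-occurrence 3SAT after Ausiello et al. 1999, Thm. 8.13).
* [GareyJohnsonStockmeyer1976] M. R. Garey, D. S. Johnson, L. Stockmeyer, *Some simplified NP-complete graph
  problems*, TCS 1 (1976), Thm. 1.1 (the ten-clause gadget).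
* [AroraBarakCC2009] S. Arora, B. Barak, *Computational Complexity: A Modern Approach*, CUP 2009, Thm. 11.9,
  §22.A Claim 22.37 (bounded occurrence), §1.3 (polynomial time), Def. 2.7 (Karp reductions).
* [PapadimitriouYannakakis1991] C. Papadimitriou, M. Yannakakis, *Optimization, approximation, and complexity
  classes*, JCSS 43 (1991) (MAX-SAT with bounded occurrence).
-/

noncomputable section

namespace Literature.Computability.Complexity

open _root_.Computability CNF Brick NegCNF
open scoped Notation

/-! ### §1. The language and its NP-hardness -/

/-- **E3SAT with occurrence bound `B`**: codes of satisfiable E3-CNFs (every clause three literals on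
three distinct variables) in which every variable occurs in at most `B` clauses — the yes-side of the
promise problem `gapE3SATOcc B ε`. [cite: BlaserIkenmeyerJindalLysikov2018, §5 (p. 13)] [cite: AroraBarakCC2009, §22.A Claim 22.37] -/
def E3SATOcc (B : ℕ) : Language Bool :=
  encodingCNF.toLanguage {φ : CNF ℕ | φ.IsExactWidth 3 ∧ (∀ x, φ.varOcc x ≤ B) ∧ φ.Satisfiable}

/-- Membership of a code in `E3SATOcc B`. [cite: BlaserIkenmeyerJindalLysikov2018, §5 (p. 13)] -/
theorem encode_mem_E3SATOcc_iff {B : ℕ} {φ : CNF ℕ} :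
    encodingCNF.encode φ ∈ E3SATOcc B ↔ φ.IsExactWidth 3 ∧ (∀ x, φ.varOcc x ≤ B) ∧ φ.Satisfiable :=
  encodingCNF.mem_toLanguage_iff _ φ

/-- A member of `E3SATOcc B` is the canonical code of its decoding. [cite: AroraBarakCC2009, §1.3 (codes)] -/
theorem encode_decCNF_of_mem_E3SATOcc {B : ℕ} {w : List Bool} (h : w ∈ E3SATOcc B) :
    encodingCNF.encode (decCNF w) = w :=
  KSATRed.encode_decCNF_of_mem h

/-- The yes-side of `gapE3SATOcc B ε` is `E3SATOcc B`. [cite: BlaserIkenmeyerJindalLysikov2018, §5 (p. 13)] -/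
theorem gapE3SATOcc_yes_eq (B : ℕ) (ε : ℚ) : (gapE3SATOcc B ε).yes = E3SATOcc B := rfl

/-- The two sides of `gapE3SATOcc B ε` are disjoint for `ε < 1/8` (a satisfiable CNF has value `1`).
[cite: AroraBarakCC2009, Thm. 11.9] -/
theorem gapE3SATOcc_disjoint (B : ℕ) {ε : ℚ} (hε : ε < 1 / 8) :
    Disjoint (gapE3SATOcc B ε).yes (gapE3SATOcc B ε).no :=
  Set.disjoint_left.2 fun _ hy hn =>
    Set.disjoint_left.1 (gapE3SAT_disjoint_holds ε hε) (gapE3SATOcc_yes_subset B ε hy) (gapE3SATOcc_no_subset B ε hn)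

/-- **A promise reduction into `gapE3SATOcc B ε` (`ε < 1/8`) is a Karp reduction to `E3SATOcc B`**: non-members go
to the no-side, which misses the yes-side. [cite: AroraBarakCC2009, Def. 2.7 and Thm. 11.9] -/
theorem E3SATOcc_isNPHard_of_gap {B : ℕ} {ε : ℚ} (hε : ε < 1 / 8) (h : (gapE3SATOcc B ε).IsNPHard) :
    IsNPHard (E3SATOcc B) := by
  intro L hL
  obtain ⟨f, hf, hy, hn⟩ := h L hL
  refine ⟨f, hf, fun x => ⟨fun hx => hy hx, fun hfx => ?_⟩⟩
  by_contra hx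
  exact Set.disjoint_left.1 (gapE3SATOcc_disjoint B hε) hfx (hn hx)

/-- **`E3SATOcc (occB ggP)` is NP-hard** (the occurrence constant of Dinur's E3-CNF on the Gabber–Galil kit).
[cite: AroraBarakCC2009, Thm. 11.9 and §22.A Claim 22.37] [cite: BlaserIkenmeyerJindalLysikov2018, §5 (p. 13)] -/
theorem E3SATOcc_occB_isNPHard : IsNPHard (E3SATOcc GabberGalil.ggP.occB) :=
  E3SATOcc_isNPHard_of_gap (by linarith [GapPV.ε₁Q_pos GabberGalil.ggP]) gapE3SATOcc_isNPHard_dinurGap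

/-- The occurrence constant of Dinur's E3-CNF is positive (stated for every round kit, so that no concrete
constant is evaluated). [cite: AroraBarakCC2009, §22.2] -/
theorem one_le_occB (P : Expander.RoundParams) : 1 ≤ P.occB := by
  unfold Expander.RoundParams.occB
  have h2 : 2 ^ BLR.Table.q₀ * (BLR.Table.q₀ + 4) ≠ 0 := Nat.mul_ne_zero (Nat.two_pow_pos _).ne' (by omega)
  exact Nat.one_le_iff_ne_zero.2 (Nat.mul_ne_zero (by omega) h2)

/-- **Bounded-occurrence E3SAT is NP-hard for some occurrence bound `B ≥ 1`.**
[cite: BlaserIkenmeyerJindalLysikov2018, §5 (p. 13)] [cite: AroraBarakCC2009, §22.A Claim 22.37] -/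
theorem exists_E3SATOcc_isNPHard : ∃ B : ℕ, 1 ≤ B ∧ IsNPHard (E3SATOcc B) :=
  ⟨_, one_le_occB _, E3SATOcc_occB_isNPHard⟩

/-! ### §2. Literal positions versus clause occurrences; the occurrence test -/

namespace CNF

/-- **The number of literal positions on the variable `x`** (with multiplicity inside a clause: the unit
clause `x ∨ x` of a 2-CNF counts twice) — the rank of the slice `A_x` of the Max-2-SAT tensor of
[BIJL18, §3]. [cite: BlaserIkenmeyerJindalLysikov2018, Obs. 12 and Obs. 17] -/
def litOcc (φ : CNF ℕ) (x : ℕ) : ℕ := (φ.flatten.map Prod.fst).count x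

/-- Literal positions of a concatenation. [cite: BlaserIkenmeyerJindalLysikov2018, Obs. 12] -/
theorem litOcc_append (φ ψ : CNF ℕ) (x : ℕ) : litOcc (φ ++ ψ) x = litOcc φ x + litOcc ψ x := by
  simp [litOcc, List.flatten_append, List.map_append, List.count_append]

/-- Literal positions of a cons. [cite: BlaserIkenmeyerJindalLysikov2018, Obs. 12] -/
theorem litOcc_cons (c : Clause ℕ) (φ : CNF ℕ) (x : ℕ) : litOcc (c :: φ) x = (c.map Prod.fst).count x + litOcc φ x := by
  simp [litOcc, List.flatten_cons, List.map_append, List.count_append]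

/-- Occurrence number of a cons. [cite: BlaserIkenmeyerJindalLysikov2018, §5 (p. 13)] -/
theorem varOcc_cons (c : Clause ℕ) (φ : CNF ℕ) (x : ℕ) :
    CNF.varOcc (c :: φ) x = (if x ∈ c.map Prod.fst then 1 else 0) + φ.varOcc x := by
  unfold CNF.varOcc
  rw [List.countP_cons]
  by_cases h : x ∈ c.map Prod.fst
  · rw [if_pos h, if_pos (decide_eq_true h)]; omega
  · rw [if_neg h, if_neg (by simpa using h)]; omega

/-- **In a CNF of width `≤ w` a variable has at most `w` literal positions per clause it occurs in:**
`litOcc φ x ≤ w · varOcc φ x`. [cite: BlaserIkenmeyerJindalLysikov2018, Obs. 12 and Obs. 17] -/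
theorem litOcc_le_mul_varOcc {w : ℕ} {φ : CNF ℕ} (hw : φ.IsWidthLE w) (x : ℕ) : litOcc φ x ≤ w * φ.varOcc x := by
  induction φ with
  | nil => simp [litOcc]
  | cons c φ ih =>
    have hc : c.length ≤ w := hw c List.mem_cons_self
    have ih' := ih fun d hd => hw d (List.mem_cons_of_mem _ hd)
    rw [litOcc_cons, varOcc_cons]
    by_cases hx : x ∈ c.map Prod.fst
    · rw [if_pos hx]
      have h1 : (c.map Prod.fst).count x ≤ w := (List.count_le_length).trans (by simpa using hc)
      nlinarith
    · rw [if_neg hx, List.count_eq_zero_of_not_mem hx, Nat.zero_add, Nat.zero_add]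
      exact ih'

/-- An occurring variable has positive occurrence number. [cite: BlaserIkenmeyerJindalLysikov2018, §5 (p. 13)] -/
theorem varOcc_pos_of_mem {φ : CNF ℕ} {c : Clause ℕ} (hc : c ∈ φ) {l : Literal ℕ} (hl : l ∈ c) : 0 < φ.varOcc l.1 := by
  unfold CNF.varOcc
  exact List.countP_pos_iff.2 ⟨c, hc, decide_eq_true (List.mem_map.2 ⟨l, hl, rfl⟩)⟩

end CNF

/-- **The occurrence test** "every variable occurs in at most `B` clauses" as a Boolean (it suffices to test
the occurring variables). [cite: BlaserIkenmeyerJindalLysikov2018, §5 (p. 13)] -/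
def occLE (B : ℕ) (φ : CNF ℕ) : Bool :=
  (φ.flatten.map Prod.fst).all fun x => decide ((φ.filter fun c => decide (x ∈ c.map Prod.fst)).length ≤ B)

/-- The occurrence number as the length of a filter. [cite: BlaserIkenmeyerJindalLysikov2018, §5 (p. 13: "every variable appears in at most c clauses")] -/
theorem varOcc_eq_length_filter (φ : CNF ℕ) (x : ℕ) :
    φ.varOcc x = (φ.filter fun c => decide (x ∈ c.map Prod.fst)).length := by
  unfold CNF.varOcc
  rw [List.countP_eq_length_filter]

/-- **`occLE B` decides the occurrence bound.** [cite: BlaserIkenmeyerJindalLysikov2018, §5 (p. 13)] -/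
theorem occLE_eq_true_iff (B : ℕ) (φ : CNF ℕ) : occLE B φ = true ↔ ∀ x, φ.varOcc x ≤ B := by
  simp only [occLE, List.all_eq_true, decide_eq_true_eq, ← varOcc_eq_length_filter]
  constructor
  · intro h x
    by_cases hx : ∃ c ∈ φ, ∃ l ∈ c, l.1 = x
    · obtain ⟨c, hc, l, hl, rfl⟩ := hx
      exact h _ (List.mem_map.2 ⟨l, List.mem_flatten.2 ⟨c, hc, hl⟩, rfl⟩)
    · push Not at hx
      rw [CNF.varOcc_eq_zero fun c hc l hl => hx c hc l hl]
      exact Nat.zero_le _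
  · intro h x _
    exact h x

/-! ### §3. Occurrences in the Garey–Johnson–Stockmeyer 2-CNF -/

namespace MaxTwoSat

open CNF

/-- Occurrence numbers over a flattened list of CNFs add up. [cite: GareyJohnsonStockmeyer1976, Thm. 1.1 (proof: the 2-CNF is the union of the clause gadgets)] -/
theorem varOcc_flatten (L : List (CNF ℕ)) (x : ℕ) : CNF.varOcc L.flatten x = (L.map fun ψ => ψ.varOcc x).sum := by
  unfold CNF.varOcc
  rw [List.countP_flatten]

/-- The variables of a gadget are those of its four literals. [cite: GareyJohnsonStockmeyer1976, Thm. 1.1 (proof)] -/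
theorem fst_mem_of_mem_gadget {a b c d : Literal ℕ} {cl : Clause ℕ} (hcl : cl ∈ gadget a b c d) {l : Literal ℕ}
    (hl : l ∈ cl) : l.1 = a.1 ∨ l.1 = b.1 ∨ l.1 = c.1 ∨ l.1 = d.1 := by
  simp only [gadget, List.mem_cons, List.not_mem_nil, or_false] at hcl
  rcases hcl with rfl | rfl | rfl | rfl | rfl | rfl | rfl | rfl | rfl | rfl <;>
    simp only [List.mem_cons, List.not_mem_nil, or_false] at hl <;>
    rcases hl with rfl | rfl <;> simp [Literal.negate]

/-- **A variable foreign to a gadget does not occur in it.** [cite: GareyJohnsonStockmeyer1976, Thm. 1.1 (proof)] -/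
theorem varOcc_gadget_eq_zero {a b c d : Literal ℕ} {x : ℕ} (ha : a.1 ≠ x) (hb : b.1 ≠ x) (hc : c.1 ≠ x) (hd : d.1 ≠ x) :
    CNF.varOcc (gadget a b c d) x = 0 :=
  CNF.varOcc_eq_zero fun _ hcl l hl h => by
    rcases fst_mem_of_mem_gadget hcl hl with h' | h' | h' | h' <;> [exact ha (h' ▸ h); exact hb (h' ▸ h);
      exact hc (h' ▸ h); exact hd (h' ▸ h)]

/-- A variable of a slot of a non-empty clause is a variable of the clause. [cite: GareyJohnsonStockmeyer1976, Thm. 1.1 (proof)] -/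
theorem slot_fst_mem {c : Clause ℕ} (hc : c ≠ []) (j : ℕ) : (slot c j).1 ∈ c.map Prod.fst :=
  List.mem_map.2 ⟨_, slot_mem hc j, rfl⟩

/-- **The gadget of clause `i` mentions `x` only if `x` is a variable of the clause or its fresh variable `N + i`**
(for a non-empty clause). [cite: GareyJohnsonStockmeyer1976, Thm. 1.1 (proof)] -/
theorem varOcc_clauseGadget_eq_zero {N i : ℕ} {c : Clause ℕ} (hc : c ≠ []) {x : ℕ} (hx : x ∉ c.map Prod.fst)
    (hN : N + i ≠ x) : CNF.varOcc (clauseGadget N i c) x = 0 :=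
  varOcc_gadget_eq_zero (fun h => hx (h ▸ slot_fst_mem hc 0)) (fun h => hx (h ▸ slot_fst_mem hc 1))
    (fun h => hx (h ▸ slot_fst_mem hc 2)) hN

/-- Every gadget has occurrence numbers `≤ 10`. [cite: GareyJohnsonStockmeyer1976, Thm. 1.1 (proof)] -/
theorem varOcc_clauseGadget_le (N i : ℕ) (c : Clause ℕ) (x : ℕ) : CNF.varOcc (clauseGadget N i c) x ≤ 10 :=
  CNF.varOcc_le_length _ _

/-- Occurrences in a flattened indexed family vanish if they vanish blockwise. [folklore] -/
private theorem varOcc_flatten_mapIdx_eq_zero (x : ℕ) :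
    ∀ (φ : CNF ℕ) (g : ℕ → Clause ℕ → CNF ℕ), (∀ i, ∀ c ∈ φ, CNF.varOcc (g i c) x = 0) →
      CNF.varOcc (φ.mapIdx g).flatten x = 0 := by
  intro φ
  induction φ with
  | nil => intro g _; rfl
  | cons c φ ih =>
    intro g hg
    rw [List.mapIdx_cons, List.flatten_cons, CNF.varOcc_append, hg 0 c List.mem_cons_self,
      ih (fun i => g (i + 1)) fun i d hd => hg (i + 1) d (List.mem_cons_of_mem _ hd)]

/-- Occurrences in a flattened indexed family supported on the blocks of the clauses containing `x`.
[folklore] -/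
private theorem varOcc_flatten_mapIdx_le_mul (x C : ℕ) :
    ∀ (φ : CNF ℕ) (g : ℕ → Clause ℕ → CNF ℕ), (∀ i, ∀ c ∈ φ, CNF.varOcc (g i c) x ≤ C) →
      (∀ i, ∀ c ∈ φ, x ∉ c.map Prod.fst → CNF.varOcc (g i c) x = 0) →
      CNF.varOcc (φ.mapIdx g).flatten x ≤ C * φ.varOcc x := by
  intro φ
  induction φ with
  | nil => intro g _ _; simp [CNF.varOcc_nil]
  | cons c φ ih =>
    intro g hC hz
    rw [List.mapIdx_cons, List.flatten_cons, CNF.varOcc_append, CNF.varOcc_cons]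
    have ih' := ih (fun i => g (i + 1)) (fun i d hd => hC (i + 1) d (List.mem_cons_of_mem _ hd))
      fun i d hd => hz (i + 1) d (List.mem_cons_of_mem _ hd)
    by_cases hx : x ∈ c.map Prod.fst
    · rw [if_pos hx]
      have := hC 0 c List.mem_cons_self
      nlinarith
    · rw [if_neg hx, hz 0 c List.mem_cons_self hx, Nat.zero_add, Nat.zero_add]
      exact ih'

/-- Occurrences in a flattened indexed family supported on a single block. [folklore] -/
private theorem varOcc_flatten_mapIdx_le_of_single (x C : ℕ) :
    ∀ (φ : CNF ℕ) (g : ℕ → Clause ℕ → CNF ℕ) (i₀ : ℕ), (∀ i, ∀ c ∈ φ, CNF.varOcc (g i c) x ≤ C) →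
      (∀ i, ∀ c ∈ φ, i ≠ i₀ → CNF.varOcc (g i c) x = 0) →
      CNF.varOcc (φ.mapIdx g).flatten x ≤ C := by
  intro φ
  induction φ with
  | nil => intro g i₀ _ _; simp [CNF.varOcc_nil]
  | cons c φ ih =>
    intro g i₀ hC hz
    rw [List.mapIdx_cons, List.flatten_cons, CNF.varOcc_append]
    by_cases h0 : i₀ = 0
    · subst h0
      rw [varOcc_flatten_mapIdx_eq_zero x φ (fun i => g (i + 1)) fun i d hd =>
        hz (i + 1) d (List.mem_cons_of_mem _ hd) (Nat.succ_ne_zero i)]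
      simpa using hC 0 c List.mem_cons_self
    · rw [hz 0 c List.mem_cons_self (Ne.symm h0), zero_add]
      exact ih (fun i => g (i + 1)) (i₀ - 1) (fun i d hd => hC (i + 1) d (List.mem_cons_of_mem _ hd))
        fun i d hd hi => hz (i + 1) d (List.mem_cons_of_mem _ hd) (by omega)

/-- **Occurrence numbers of the Garey–Johnson–Stockmeyer 2-CNF**: in `gjs φ` (for `φ` without empty
clauses) every variable occurs in at most `10 (varOcc φ x + 1)` clauses — a variable of `φ` only in the
ten-clause gadgets of the clauses containing it, a fresh variable `numVars φ + i` only in the gadget of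
clause `i`. (So bounded occurrence is preserved, which the "constant `c`" of [BIJL18, Obs. 17] needs.)
[cite: GareyJohnsonStockmeyer1976, Thm. 1.1 (proof)] [cite: BlaserIkenmeyerJindalLysikov2018, Obs. 17] -/
theorem varOcc_gjs_le {φ : CNF ℕ} (h0 : [] ∉ φ) (x : ℕ) : CNF.varOcc (gjs φ) x ≤ 10 * (φ.varOcc x + 1) := by
  have hne : ∀ c ∈ φ, c ≠ [] := fun c hc he => h0 (he ▸ hc)
  by_cases hx : x < φ.numVars
  · have h := varOcc_flatten_mapIdx_le_mul x 10 φ (clauseGadget φ.numVars)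
      (fun i c _ => varOcc_clauseGadget_le _ _ _ _)
      fun i c hc hxc => varOcc_clauseGadget_eq_zero (hne c hc) hxc (by omega)
    rw [gjs]
    nlinarith [h]
  · have hout : ∀ c ∈ φ, x ∉ c.map Prod.fst := fun c hc hxc => by
      obtain ⟨l, hl, rfl⟩ := List.mem_map.1 hxc
      exact hx (lt_numVars_of_mem_of_mem hc hl)
    have h := varOcc_flatten_mapIdx_le_of_single x 10 φ (clauseGadget φ.numVars) (x - φ.numVars)
      (fun i c _ => varOcc_clauseGadget_le _ _ _ _)
      fun i c hc hi => varOcc_clauseGadget_eq_zero (hne c hc) (hout c hc) (by omega)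
    rw [gjs]
    omega

/-- An E3-CNF has width `≤ 3` and no empty clause. [cite: GareyJohnsonStockmeyer1976, Thm. 1.1] -/
theorem isWidthLE_and_nil_not_mem_of_isExactWidth {φ : CNF ℕ} (h : φ.IsExactWidth 3) :
    φ.IsWidthLE 3 ∧ [] ∉ φ :=
  ⟨h.isWidthLE, fun h0 => by simpa using (h [] h0).1⟩

/-- **`7m` clauses of `gjs φ` are simultaneously satisfiable iff the E3-CNF `φ` is satisfiable** (the
tree's `eval_of_le_numSatClauses_gjs` / `numSatClauses_gjs_extend` read for E3-CNFs).
[cite: GareyJohnsonStockmeyer1976, Thm. 1.1] -/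
theorem exists_numSatClauses_gjs_iff_of_isExactWidth {φ : CNF ℕ} (h : φ.IsExactWidth 3) :
    (∃ τ : ℕ → Bool, 7 * φ.length ≤ (gjs φ).numSatClauses τ) ↔ φ.Satisfiable := by
  obtain ⟨h3, h0⟩ := isWidthLE_and_nil_not_mem_of_isExactWidth h
  exact ⟨fun ⟨τ, hτ⟩ => ⟨τ, eval_of_le_numSatClauses_gjs h3 h0 hτ⟩,
    fun ⟨σ, hσ⟩ => ⟨extend φ σ, (numSatClauses_gjs_extend h3 h0 hσ).ge⟩⟩

/-- The occurrence numbers of the 2-CNF of an E3-CNF with occurrence bound `B`: `≤ 10 (B + 1)`.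
[cite: BlaserIkenmeyerJindalLysikov2018, Obs. 17] [cite: GareyJohnsonStockmeyer1976, Thm. 1.1 (proof)] -/
theorem varOcc_gjs_le_of_isExactWidth {φ : CNF ℕ} (h : φ.IsExactWidth 3) {B : ℕ} (hB : ∀ x, φ.varOcc x ≤ B)
    (x : ℕ) : CNF.varOcc (gjs φ) x ≤ 10 * (B + 1) :=
  (varOcc_gjs_le (isWidthLE_and_nil_not_mem_of_isExactWidth h).2 x).trans (by nlinarith [hB x])

/-- The literal positions of the 2-CNF of an E3-CNF with occurrence bound `B`: `≤ 20 (B + 1)` — the slice-rank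
bound `c` of [BIJL18, Obs. 17] for these instances. [cite: BlaserIkenmeyerJindalLysikov2018, Obs. 17] -/
theorem litOcc_gjs_le_of_isExactWidth {φ : CNF ℕ} (h : φ.IsExactWidth 3) {B : ℕ} (hB : ∀ x, φ.varOcc x ≤ B)
    (x : ℕ) : CNF.litOcc (gjs φ) x ≤ 20 * (B + 1) :=
  (CNF.litOcc_le_mul_varOcc (isWidthEq_two_gjs φ).isWidthLE x).trans (by
    have := varOcc_gjs_le_of_isExactWidth h hB x; omega)

end MaxTwoSat

/-! ### §4. A satisfiability-neutral E3 padding on fresh variables -/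

/-- The `i`-th padding clause `x_{N+3i} ∨ x_{N+3i+1} ∨ x_{N+3i+2}` (device for the "let `n` be large
enough" step of the proof of BIJL Thm. 4 when the instance size must grow without changing the answer).
[cite: BlaserIkenmeyerJindalLysikov2018, §3 (proof of Thm. 4, ECCC p. 11: "let n be large enough")] -/
def padClause (N i : ℕ) : Clause ℕ := [(N + 3 * i, true), (N + 3 * i + 1, true), (N + 3 * i + 2, true)]

/-- **`padE3 j φ`**: `φ` followed by `j` always-satisfiable E3 clauses on fresh variables
(`N = numVars φ`). [cite: BlaserIkenmeyerJindalLysikov2018, §3 (proof of Thm. 4, ECCC p. 11: "let n be large enough")] -/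
def padE3 (j : ℕ) (φ : CNF ℕ) : CNF ℕ := φ ++ (List.range j).map (padClause φ.numVars)

/-- `padE3 j` adds `j` clauses. [cite: BlaserIkenmeyerJindalLysikov2018, §3 (proof of Thm. 4, ECCC p. 11: "let n be large enough")] -/
@[simp] theorem length_padE3 (j : ℕ) (φ : CNF ℕ) : (padE3 j φ).length = φ.length + j := by
  simp [padE3]

/-- A padding clause is an E3 clause. [cite: BlaserIkenmeyerJindalLysikov2018, §3 (proof of Thm. 4, ECCC p. 11: "let n be large enough")] -/
theorem length_padClause (N i : ℕ) : (padClause N i).length = 3 := rfl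

/-- The variables of a padding clause are distinct. [cite: BlaserIkenmeyerJindalLysikov2018, §3 (proof of Thm. 4, ECCC p. 11: "let n be large enough")] -/
theorem nodup_padClause (N i : ℕ) : ((padClause N i).map Prod.fst).Nodup := by
  simp [padClause]

/-- The variables of a padding clause. [cite: BlaserIkenmeyerJindalLysikov2018, §3 (proof of Thm. 4, ECCC p. 11: "let n be large enough")] -/
theorem mem_map_fst_padClause {N i x : ℕ} : x ∈ (padClause N i).map Prod.fst ↔ x = N + 3 * i ∨ x = N + 3 * i + 1 ∨ x = N + 3 * i + 2 := by
  simp [padClause]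

/-- **Padding preserves exact width `3`.** [cite: BlaserIkenmeyerJindalLysikov2018, §3 (proof of Thm. 4, ECCC p. 11: "let n be large enough")] -/
theorem isExactWidth_padE3 {φ : CNF ℕ} (h : φ.IsExactWidth 3) (j : ℕ) : (padE3 j φ).IsExactWidth 3 := by
  intro c hc
  rcases List.mem_append.1 hc with hc | hc
  · exact h c hc
  · obtain ⟨i, -, rfl⟩ := List.mem_map.1 hc
    exact ⟨length_padClause _ _, nodup_padClause _ _⟩

/-- A padding clause is satisfied by every assignment that is `true` on its first variable, e.g. by the
assignment made `true` above `numVars φ`. [cite: BlaserIkenmeyerJindalLysikov2018, §3 (proof of Thm. 4, ECCC p. 11: "let n be large enough")] -/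
theorem eval_padClause_of (N i : ℕ) {σ : ℕ → Bool} (hσ : σ (N + 3 * i) = true) : Clause.eval σ (padClause N i) = true := by
  simp [padClause, Clause.eval, Literal.eval, hσ]

/-- **Padding preserves satisfiability.** [cite: BlaserIkenmeyerJindalLysikov2018, §3 (proof of Thm. 4, ECCC p. 11: "let n be large enough")] -/
theorem satisfiable_padE3_iff (j : ℕ) (φ : CNF ℕ) : (padE3 j φ).Satisfiable ↔ φ.Satisfiable := by
  constructor
  · rintro ⟨σ, hσ⟩
    refine ⟨σ, (eval_eq_true_iff _ _).2 fun c hc => (eval_eq_true_iff _ _).1 hσ c (List.mem_append_left _ hc)⟩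
  · rintro ⟨σ, hσ⟩
    refine ⟨fun x => if x < φ.numVars then σ x else true, (eval_eq_true_iff _ _).2 fun c hc => ?_⟩
    rcases List.mem_append.1 hc with hc | hc
    · have hc' := (eval_eq_true_iff _ _).1 hσ c hc
      rw [Clause.eval, List.any_eq_true] at hc' ⊢
      obtain ⟨l, hl, hv⟩ := hc'
      refine ⟨l, hl, ?_⟩
      simp only [Literal.eval, if_pos (lt_numVars_of_mem_of_mem hc hl)] at hv ⊢
      exact hv
    · obtain ⟨i, -, rfl⟩ := List.mem_map.1 hc
      exact eval_padClause_of _ _ (by simp)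

/-- The occurrence numbers of the padding block: at most one, and zero below `N`. [cite: BlaserIkenmeyerJindalLysikov2018, §3 (proof of Thm. 4, ECCC p. 11: "let n be large enough")] -/
theorem varOcc_padBlock_le (N j x : ℕ) : CNF.varOcc ((List.range j).map (padClause N)) x ≤ if x < N then 0 else 1 := by
  induction j with
  | zero => simp [CNF.varOcc_nil]
  | succ j ih =>
    rw [List.range_succ, List.map_append, List.map_singleton, CNF.varOcc_append]
    have h1 : CNF.varOcc [padClause N j] x = if x ∈ (padClause N j).map Prod.fst then 1 else 0 := by
      rw [CNF.varOcc_cons, CNF.varOcc_nil, Nat.add_zero]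
    rw [h1]
    by_cases hx : x ∈ (padClause N j).map Prod.fst
    · rw [if_pos hx]
      have hx' := mem_map_fst_padClause.1 hx
      have hz : CNF.varOcc ((List.range j).map (padClause N)) x = 0 :=
        CNF.varOcc_eq_zero fun c hc l hl hlx => by
          obtain ⟨i, hi, rfl⟩ := List.mem_map.1 hc
          have := mem_map_fst_padClause.1 (List.mem_map.2 ⟨l, hl, hlx⟩)
          rw [List.mem_range] at hi
          omega
      rw [hz]
      split_ifs with h <;> omega
    · rw [if_neg hx, Nat.add_zero]
      exact ih

/-- **Padding raises occurrence numbers by at most one, and not at all on the variables of `φ`.**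
[cite: BlaserIkenmeyerJindalLysikov2018, §3 (proof of Thm. 4, ECCC p. 11: "let n be large enough")] -/
theorem varOcc_padE3_le (j : ℕ) (φ : CNF ℕ) (x : ℕ) : (padE3 j φ).varOcc x ≤ max (φ.varOcc x) 1 := by
  rw [padE3, CNF.varOcc_append]
  have h := varOcc_padBlock_le φ.numVars j x
  by_cases hx : x < φ.numVars
  · rw [if_pos hx] at h
    have : CNF.varOcc (List.map (padClause φ.numVars) (List.range j)) x = 0 := Nat.le_zero.1 h
    rw [this, Nat.add_zero]
    exact le_max_left _ _
  · rw [if_neg hx] at h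
    have h0 : φ.varOcc x = 0 := CNF.varOcc_eq_zero fun c hc l hl hlx =>
      hx (hlx ▸ lt_numVars_of_mem_of_mem hc hl)
    rw [h0, Nat.zero_add]
    exact h.trans (le_max_right _ _)

/-- Padding keeps an occurrence bound `B ≥ 1`. [cite: BlaserIkenmeyerJindalLysikov2018, §3 (proof of Thm. 4, ECCC p. 11: "let n be large enough")] -/
theorem varOcc_padE3_le_of_le {φ : CNF ℕ} {B : ℕ} (hB : ∀ x, φ.varOcc x ≤ B) (h1 : 1 ≤ B) (j x : ℕ) :
    (padE3 j φ).varOcc x ≤ B :=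
  (varOcc_padE3_le j φ x).trans (max_le (hB x) h1)

/-! ### §5. The string functions (typed `CodeFP` algebra) -/

namespace MaxTwoSat

open CodeFP

/-- **The occurrence test on codes.** [cite: AroraBarakCC2009, §1.3 (polynomial time: bounded loops)] -/
theorem occLEFP (B : ℕ) : CodeFP cnfE bitE (occLE B) := by
  -- the inner test `x ∈ c.map fst` on a (variable, raw clause) pair
  have hmem : CodeFP (pairE natE (rawE litE)) bitE (fun t => decide (t.1 ∈ t.2.map Prod.fst)) :=
    (mem natE_injective).comp ((fst _ _).pair ((map₀ (fst natE bitE)).comp (snd _ _)))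
  -- the count `|filter (x ∈ ·) φ| ≤ B` on a (variable, raw CNF) pair
  have hcount : CodeFP (pairE natE (rawE (rawE litE))) bitE
      (fun t => decide ((t.2.filter fun c => decide (t.1 ∈ c.map Prod.fst)).length ≤ B)) :=
    (natLe.comp (((natLength (rawE litE)).comp (filter hmem)).pair (const _ B))).congr fun _ => rfl
  -- with the context a CNF code and the item a variable
  have hp : CodeFP (pairE cnfE natE) bitE
      (fun q => decide ((q.1.filter fun c => decide (q.2 ∈ c.map Prod.fst)).length ≤ B)) :=
    (hcount.comp ((snd _ _).pair (clausesFP.comp (fst _ _)))).congr fun _ => rfl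
  have hvars : CodeFP cnfE (rawE natE) (fun φ : CNF ℕ => φ.flatten.map Prod.fst) :=
    ((map₀ (fst natE bitE)).comp ((CodeFP.flatten litE).comp clausesFP)).congr fun _ => rfl
  exact ((all hp).comp ((CodeFP.id _).pair hvars)).congr fun _ => rfl

/-- The padding clause on codes, from `(N, i)`. [cite: AroraBarakCC2009, §1.3] -/
theorem padClauseFP : CodeFP (pairE natE natE) (rawE litE) (fun p => padClause p.1 p.2) := by
  have hv : CodeFP (pairE natE natE) natE (fun p => p.1 + 3 * p.2) :=
    (natAdd.comp ((fst _ _).pair ((natMul.comp ((const _ 3).pair (snd _ _))).congr fun _ => rfl))).congr fun _ => rfl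
  have hv1 : CodeFP (pairE natE natE) natE (fun p => p.1 + 3 * p.2 + 1) :=
    (natAdd.comp (hv.pair (const _ 1))).congr fun _ => rfl
  have hv2 : CodeFP (pairE natE natE) natE (fun p => p.1 + 3 * p.2 + 2) :=
    (natAdd.comp (hv.pair (const _ 2))).congr fun _ => rfl
  have hl : ∀ {g : ℕ × ℕ → ℕ}, CodeFP (pairE natE natE) natE g →
      CodeFP (pairE natE natE) litE (fun p => ((g p, true) : Literal ℕ)) := fun hg =>
    (hg.pair (const _ true)).congr fun _ => rfl
  exact ((rawCons litE).comp ((hl hv).pair ((rawCons litE).comp ((hl hv1).pair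
    ((rawCons litE).comp ((hl hv2).pair (const _ ([] : Clause ℕ)))))))).congr fun _ => rfl

/-- **The padding on codes.** [cite: AroraBarakCC2009, §1.3 (polynomial time: bounded loops)] -/
theorem padE3FP (j : ℕ) : CodeFP cnfE cnfE (padE3 j) := by
  have hblock : CodeFP cnfE (rawE (rawE litE)) (fun φ : CNF ℕ => (List.range j).map (padClause φ.numVars)) :=
    ((map (σ := CNF ℕ) (α := ℕ) (g := fun q => padClause q.1.numVars q.2)
      (padClauseFP.comp ((numVarsFP.comp (fst _ _)).pair (snd _ _)))).comp
      ((CodeFP.id _).pair (const _ (List.range j)))).congr fun _ => rfl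
  exact (cnfOfRawFP.comp ((rawAppend (rawE litE)).comp (clausesFP.pair hblock))).congr fun _ => rfl

end MaxTwoSat

end Literature.Computability.Complexity

end
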